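import Summits.CriticalPhenomena.PercolationContinuityZ3.Theorems.PercNearOneGluingNoHeavyPcintChordDiagramCount
import Summits.CriticalPhenomena.PercolationContinuityZ3.Theorems.PercNearOneGluingNoHeavyPcintClosingCountBinomial
import HarnessLib

/-!
# CriticalPhenomena/PercolationContinuityZ3 — Theorems/PercNearOneGluingNoHeavyPcintClosingWordDiagram.lean: a return word is SELF-AVOIDING iff its chord diagram is IRREDUCIBLE (combinatorial core of STRUCTURE law C5-L1, part 4)

Lane prim-pcint, STRUCTURE rule «numerics ⇒ structure ⇒ conjecture» (prim-pcint-2 GEN 20); sequel of …PcintChordDiagramCount.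
The bridge between the tree's step words (`Fin K → Fin j × Bool`, positions `wordPos`, `IsSAW`) and the chord diagrams of …PcintChordDiagrams.
A word `w` of length `K` is COMPATIBLE (`Compat π w`) with a diagram `π` on the `K + 1` points `0, …, K` (the `K` letters and a virtual last
point standing for the closing step) when partnered letters carry the same axis with opposite signs and equal axes occur only at partners.  Then:
* block sums of steps vanish exactly on closed blocks: `Σ_{t ∈ I} stepVec (w t) = 0 ↔ Closed π I` for every set `I` of letters
  (`sum_stepVec_eq_zero_iff`; the paired letters cancel by `Finset.sum_involution`, the dangling ones carry pairwise distinct axes);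
* positions are block sums (`wordPos_add_eq_sum`), so `IsSAW w ↔` no block of consecutive letters has vanishing step sum (`isSAW_iff_blocks`),
  while `IsGood π ↔` no proper block of consecutive points avoiding the top is closed (`isGood_iff_blocks`); hence
  **`isSAW_iff_isGood`: a compatible word is self-avoiding iff its diagram is irreducible**;
* the endpoint of a compatible word is the unit step of its unpartnered letter (`wordPos_length_eq`), so it ends next to the origin
  (`l1_wordPos_length`).
The sequel …PcintClosingWordCount turns this into the count `fullClosingCount m (2m) = m!·2^m·connChord m`.

HONEST FRAMING: elementary finite combinatorics written for the proof of `polygonLeadingCoeffLaw` (all `m`).  No `sorry`; standard axioms.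
Written by prim-pcint-2 gen 20 (prover-prim-pcint-2-g20-0), 2026-08-26.
-/

noncomputable section

namespace Summit.CriticalPhenomena.PercolationContinuityZ3.Theorems.Pcint.ChordDiag

open Literature.Probability.LatticeModels Literature.Probability.Percolation
open Summit.CriticalPhenomena.PercolationContinuityZ3.Theorems.Pcint
open Summit.CriticalPhenomena.PercolationContinuityZ3.Theorems.Pcint.MemoryTail

variable {K j : ℕ}

/-! ### Positions are block sums; self-avoidance -/

/-- The empty block. [folklore] -/
theorem blockOf_zero (K a : ℕ) : blockOf K a 0 = ∅ := by
  ext t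
  simp only [mem_blockOf, Finset.notMem_empty, iff_false]
  omega

/-- Growing a block by one point. [folklore] -/
theorem blockOf_succ {K a r : ℕ} (h : a + r < K) : blockOf K a (r + 1) = insert ⟨a + r, h⟩ (blockOf K a r) := by
  ext t
  simp only [mem_blockOf, Finset.mem_insert, Fin.ext_iff]
  omega

/-- The new point is new. [folklore] -/
theorem not_mem_blockOf_end {K a r : ℕ} (h : a + r < K) : (⟨a + r, h⟩ : Fin K) ∉ blockOf K a r := by
  simp [mem_blockOf]

/-- The full block. [folklore] -/
theorem blockOf_zero_length (K : ℕ) : blockOf K 0 K = Finset.univ := by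
  ext t
  simp only [mem_blockOf, Finset.mem_univ, iff_true]
  exact ⟨Nat.zero_le _, by simp⟩

/-- **Positions are block sums of steps**: `wordPos w (a + r) = wordPos w a + Σ_{a ≤ t < a+r} stepVec (w t)`. [folklore] -/
theorem wordPos_add_eq_sum (w : Fin K → Fin j × Bool) (a : ℕ) :
    ∀ r, a + r ≤ K → wordPos w (a + r) = wordPos w a + ∑ t ∈ blockOf K a r, stepVec (w t)
  | 0, _ => by simp [blockOf_zero]
  | r + 1, h => by
    rw [← Nat.add_assoc, wordPos_succ w (show a + r < K by omega), wordPos_add_eq_sum w a r (by omega),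
      blockOf_succ (show a + r < K by omega), Finset.sum_insert (not_mem_blockOf_end _), add_assoc, add_comm (stepVec _)]

/-- The endpoint is the sum of all steps. [folklore] -/
theorem wordPos_length_eq_sum (w : Fin K → Fin j × Bool) : wordPos w K = ∑ t, stepVec (w t) := by
  have := wordPos_add_eq_sum w 0 K (by simp)
  rw [Nat.zero_add, wordPos_zero, zero_add, blockOf_zero_length] at this
  exact this

/-- **Self-avoidance = no block of consecutive steps sums to zero.** [folklore] -/
theorem isSAW_iff_blocks (w : Fin K → Fin j × Bool) :
    IsSAW w ↔ ∀ a r, 1 ≤ r → a + r ≤ K → ∑ t ∈ blockOf K a r, stepVec (w t) ≠ 0 := by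
  constructor
  · intro h a r hr hK hs
    have := h (a + r) a hK (by omega) (by rw [wordPos_add_eq_sum w a r hK, hs, add_zero])
    omega
  · intro h i i' hi hi' heq
    rcases lt_trichotomy i i' with hii | rfl | hii
    · exfalso
      obtain ⟨r, rfl⟩ : ∃ r, i' = i + r := ⟨i' - i, by omega⟩
      rw [wordPos_add_eq_sum w i r hi'] at heq
      exact h i r (by omega) hi' (add_eq_left.1 heq.symm)
    · rfl
    · exfalso
      obtain ⟨r, rfl⟩ : ∃ r, i = i' + r := ⟨i - i', by omega⟩
      rw [wordPos_add_eq_sum w i' r hi] at heq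
      exact h i' r (by omega) hi (add_eq_left.1 heq)

/-! ### Irreducibility on `Fin (K+1)` = no closed block of consecutive points avoiding the top -/

/-- **Irreducibility in block form**: a diagram on `Fin (K+1)` is irreducible iff no non-empty block of consecutive points avoiding the top is
closed. [folklore] -/
theorem isGood_iff_blocks {π : Fin (K + 1) → Fin (K + 1)} (hd : IsDiag π) :
    IsGood π ↔ ∀ a r, 1 ≤ r → a + r ≤ K → ¬ Closed π (blockOf (K + 1) a r) := by
  constructor
  · intro hg a r hr hK hcl
    rcases hg.2 _ convex_blockOf hcl with h0 | h1
    · have : (⟨a, by omega⟩ : Fin (K + 1)) ∈ blockOf (K + 1) a r := mem_blockOf.2 ⟨le_rfl, by simp; omega⟩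
      rw [h0] at this; exact Finset.notMem_empty _ this
    · have := mem_blockOf.1 (Finset.eq_univ_iff_forall.1 h1 (Fin.last K))
      rw [Fin.val_last] at this; omega
  · intro h
    refine ⟨hd, fun I hIc hIcl => ?_⟩
    by_contra hne
    rw [not_or] at hne
    -- a non-empty convex closed block avoiding the top contradicts `h`
    have key : ∀ J : Finset (Fin (K + 1)), Convex J → Closed π J → J.Nonempty → Fin.last K ∉ J → False := by
      intro J hJc hJcl hJne hJz
      have hJ := hJc.eq_blockOf hJne
      have hmax : ((J.max' hJne : Fin (K + 1)) : ℕ) < K := by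
        have h1 := (J.max' hJne).2
        have h2 : ((J.max' hJne : Fin (K + 1)) : ℕ) ≠ K := fun h' =>
          hJz ((show Fin.last K = J.max' hJne from Fin.ext (by simp [h'])) ▸ Finset.max'_mem J hJne)
        omega
      have hmm := Fin.le_iff_val_le_val.1 (Finset.min'_le J _ (Finset.max'_mem J hJne))
      refine h (J.min' hJne) (((J.max' hJne : Fin (K + 1)) : ℕ) + 1 - J.min' hJne) (by omega) (by omega) ?_
      rw [← hJ]; exact hJcl
    by_cases hz : Fin.last K ∈ I
    · refine key Iᶜ ?_ (hd.closed_compl hIcl) ?_ (by simp [hz])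
      · intro x hx y hy t hxt hty
        rw [Finset.mem_compl] at hx hy ⊢
        exact fun ht => hy (hIc ht hz hty (Fin.le_last _))
      · obtain ⟨y, hy⟩ : ∃ y, y ∉ I := by
          by_contra hall; push Not at hall
          exact hne.2 (Finset.eq_univ_iff_forall.2 hall)
        exact ⟨y, Finset.mem_compl.2 hy⟩
    · exact key I hIc hIcl (Finset.nonempty_iff_ne_empty.2 hne.1) hz

/-! ### Words compatible with a diagram -/

/-- The real partner of a letter (itself if its partner is the virtual top point). [folklore] -/
def pre (π : Fin (K + 1) → Fin (K + 1)) (t : Fin K) : Fin K :=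
  if h : π (Fin.castSucc t) ≠ Fin.last K then (π (Fin.castSucc t)).castPred h else t

/-- The real partner, when the partner is real. [folklore] -/
theorem pre_eq_of {π : Fin (K + 1) → Fin (K + 1)} {t s : Fin K} (h : π (Fin.castSucc t) = Fin.castSucc s) : pre π t = s := by
  unfold pre
  have hne : π (Fin.castSucc t) ≠ Fin.last K := by rw [h]; exact (Fin.castSucc_lt_last s).ne
  rw [dif_pos hne]
  apply Fin.castSucc_injective
  rw [Fin.castSucc_castPred, h]

/-- **Compatibility** of a word with a diagram on its letters plus a virtual top point: partnered letters carry the same axis with opposite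
signs, and two distinct letters with the same axis are partners. [folklore] -/
def Compat (π : Fin (K + 1) → Fin (K + 1)) (w : Fin K → Fin j × Bool) : Prop :=
  (∀ s t : Fin K, π (Fin.castSucc s) = Fin.castSucc t → w t = srev (w s)) ∧
    (∀ s t : Fin K, s ≠ t → (w s).1 = (w t).1 → π (Fin.castSucc s) = Fin.castSucc t)

/-- Membership in the image of a set of letters among the points. [folklore] -/
theorem mem_map_castSucc {I : Finset (Fin K)} {x : Fin (K + 1)} : x ∈ I.map Fin.castSuccEmb ↔ ∃ s ∈ I, Fin.castSucc s = x := by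
  rw [Finset.mem_map]; rfl

/-- **Paired letters cancel**: the step sum over `I` equals the step sum over the letters of `I` whose partner is not in `I`. [folklore] -/
theorem sum_stepVec_eq_sum_dangling {π : Fin (K + 1) → Fin (K + 1)} (hd : IsDiag π) {w : Fin K → Fin j × Bool} (hc : Compat π w)
    (I : Finset (Fin K)) :
    ∑ t ∈ I, stepVec (w t) = ∑ t ∈ I.filter (fun t => π (Fin.castSucc t) ∉ I.map Fin.castSuccEmb), stepVec (w t) := by
  classical
  rw [← Finset.sum_filter_add_sum_filter_not I (fun t => π (Fin.castSucc t) ∈ I.map Fin.castSuccEmb)]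
  conv_rhs => rw [← zero_add (∑ t ∈ I.filter _, stepVec (w t))]
  congr 1
  refine Finset.sum_involution (fun t _ => pre π t) ?_ ?_ ?_ ?_
  · intro t ht
    obtain ⟨-, hpt⟩ := Finset.mem_filter.1 ht
    obtain ⟨s, -, hs⟩ := mem_map_castSucc.1 hpt
    rw [pre_eq_of hs.symm, hc.1 t s hs.symm, stepVec_srev, add_neg_cancel]
  · intro t ht _
    obtain ⟨-, hpt⟩ := Finset.mem_filter.1 ht
    obtain ⟨s, -, hs⟩ := mem_map_castSucc.1 hpt
    rw [pre_eq_of hs.symm]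
    intro hst
    rw [hst] at hs
    exact (hd _).2 hs.symm
  · intro t ht
    obtain ⟨htI, hpt⟩ := Finset.mem_filter.1 ht
    obtain ⟨s, hsI, hs⟩ := mem_map_castSucc.1 hpt
    rw [pre_eq_of hs.symm, Finset.mem_filter]
    refine ⟨hsI, mem_map_castSucc.2 ⟨t, htI, ?_⟩⟩
    rw [hs, (hd _).1]
  · intro t ht
    obtain ⟨-, hpt⟩ := Finset.mem_filter.1 ht
    obtain ⟨s, -, hs⟩ := mem_map_castSucc.1 hpt
    rw [pre_eq_of hs.symm]
    exact pre_eq_of (by rw [hs, (hd _).1])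

/-- **Block sums vanish exactly on closed blocks** (compatible word, diagram). [folklore] -/
theorem sum_stepVec_eq_zero_iff {π : Fin (K + 1) → Fin (K + 1)} (hd : IsDiag π) {w : Fin K → Fin j × Bool} (hc : Compat π w)
    (I : Finset (Fin K)) :
    ∑ t ∈ I, stepVec (w t) = 0 ↔ Closed π (I.map Fin.castSuccEmb) := by
  classical
  rw [sum_stepVec_eq_sum_dangling hd hc I]
  set D := I.filter (fun t => π (Fin.castSucc t) ∉ I.map Fin.castSuccEmb) with hD
  have hclosed : Closed π (I.map Fin.castSuccEmb) ↔ D = ∅ := by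
    rw [hD, Finset.filter_eq_empty_iff]
    constructor
    · intro h t ht; exact not_not.2 (h (mem_map_castSucc.2 ⟨t, ht, rfl⟩))
    · intro h x hx
      obtain ⟨t, ht, rfl⟩ := mem_map_castSucc.1 hx
      exact not_not.1 (h ht)
  rw [hclosed]
  constructor
  · intro h0
    by_contra hne
    obtain ⟨s, hs⟩ := Finset.nonempty_iff_ne_empty.2 hne
    have hsD := hs
    rw [hD, Finset.mem_filter] at hsD
    -- evaluate the sum at the axis of `s`: only `s` contributes
    have h1 := congrFun h0 (w s).1
    rw [Finset.sum_apply, Pi.zero_apply, Finset.sum_eq_single_of_mem s hs] at h1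
    · rw [stepVec_apply_fst] at h1
      rcases Bool.eq_false_or_eq_true (w s).2 with hb | hb <;> simp [hb] at h1
    · intro t ht hts
      rw [stepVec_apply, if_neg]
      intro hax
      have htD := ht
      rw [hD, Finset.mem_filter] at htD
      exact htD.2 (by rw [hc.2 t s hts hax.symm]; exact mem_map_castSucc.2 ⟨s, hsD.1, rfl⟩)
  · intro h; rw [h, Finset.sum_empty]

/-- Letters embed as points block by block. [folklore] -/
theorem map_castSucc_blockOf {K a r : ℕ} (h : a + r ≤ K) : (blockOf K a r).map Fin.castSuccEmb = blockOf (K + 1) a r := by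
  ext x
  rw [mem_map_castSucc, mem_blockOf]
  constructor
  · rintro ⟨s, hs, rfl⟩
    simpa [mem_blockOf] using hs
  · rintro ⟨h1, h2⟩
    refine ⟨⟨x, by omega⟩, mem_blockOf.2 ⟨h1, h2⟩, Fin.ext rfl⟩

/-- **A compatible word is self-avoiding iff its diagram is irreducible.** [folklore] -/
theorem isSAW_iff_isGood {π : Fin (K + 1) → Fin (K + 1)} (hd : IsDiag π) {w : Fin K → Fin j × Bool} (hc : Compat π w) :
    IsSAW w ↔ IsGood π := by
  rw [isSAW_iff_blocks, isGood_iff_blocks hd]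
  refine forall_congr' fun a => forall_congr' fun r => forall_congr' fun _ => forall_congr' fun hK => ?_
  rw [Ne, sum_stepVec_eq_zero_iff hd hc, map_castSucc_blockOf hK]

/-- The letter whose partner is the virtual top point. [folklore] -/
def lone {π : Fin (K + 1) → Fin (K + 1)} (hd : IsDiag π) : Fin K := (π (Fin.last K)).castPred (hd _).2

/-- The lone letter is the partner of the top. [folklore] -/
theorem castSucc_lone {π : Fin (K + 1) → Fin (K + 1)} (hd : IsDiag π) : Fin.castSucc (lone hd) = π (Fin.last K) := by
  simp [lone]

/-- A letter is partnered with the top iff it is the lone letter. [folklore] -/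
theorem eq_last_iff {π : Fin (K + 1) → Fin (K + 1)} (hd : IsDiag π) (t : Fin K) : π (Fin.castSucc t) = Fin.last K ↔ t = lone hd := by
  constructor
  · intro h
    apply Fin.castSucc_injective
    rw [castSucc_lone, ← h, (hd _).1]
  · rintro rfl
    rw [castSucc_lone, (hd _).1]

/-- **The endpoint of a compatible word is the unit step of its lone letter.** [folklore] -/
theorem wordPos_length_eq {π : Fin (K + 1) → Fin (K + 1)} (hd : IsDiag π) {w : Fin K → Fin j × Bool} (hc : Compat π w) :
    wordPos w K = stepVec (w (lone hd)) := by
  classical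
  rw [wordPos_length_eq_sum, sum_stepVec_eq_sum_dangling hd hc Finset.univ]
  have hfilter : (Finset.univ.filter fun t : Fin K => π (Fin.castSucc t) ∉ (Finset.univ : Finset (Fin K)).map Fin.castSuccEmb)
      = {lone hd} := by
    ext t
    rw [Finset.mem_filter, Finset.mem_singleton, ← eq_last_iff hd t]
    simp only [Finset.mem_univ, true_and, mem_map_castSucc, not_exists]
    constructor
    · intro h
      rcases Fin.eq_castSucc_or_eq_last (π (Fin.castSucc t)) with ⟨s, hs⟩ | h'
      · exact absurd hs.symm (h s)
      · exact h'
    · intro h s hs; rw [h] at hs; exact (Fin.castSucc_lt_last s).ne hs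
  rw [hfilter, Finset.sum_singleton]

/-- **A compatible word ends next to the origin.** [folklore] -/
theorem l1_wordPos_length {π : Fin (K + 1) → Fin (K + 1)} (hd : IsDiag π) {w : Fin K → Fin j × Bool} (hc : Compat π w) :
    l1 (wordPos w K) = 1 := by
  rw [wordPos_length_eq hd hc, l1_stepVec]

end Summit.CriticalPhenomena.PercolationContinuityZ3.Theorems.Pcint.ChordDiag
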